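import Summits.Ventures.PercRepro.C025ProfileOneFlatRowsInj
import Summits.Ventures.PercRepro.C025ProfileOneFlatAllTau

/-!
# EVERY ROW `(q,u)` OF (Π) ON «`U_{r,n}` WITH ONE FAT FLAT», EVERY SIZE — AND C-025 AT EVERY `(p,q)` THERE (night-3 g25)

`proofs/NIGHT3-G25-GRADED.md` §2–§3 and (II)–(III).  On night-1's `modelMatroid hE F s r = T_r(U_{s,F} ⊕ U_{E∖F,E∖F})`
(`s ≤ r`; `k = #F`, `m = #(E ∖ F)`) every row `(q, u)` of (Π) with `q < u < r` holds, for EVERY `k, m, r, q, u` — no regime: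
a member with `i` fat points has complement rank `min(r, min(k−i,s) + (m − (q − min(i,s))))` (`eRk_compl_eq`), its price is at
most the price of the UNTRUNCATED complement rank `p' = min(k−i,s) + (m − (q − min(i,s)))` (`price_le_type`: the price is
monotone in the complement rank, and `C(p'+q,u)/C(p'+q,q) = C(p', u−q)/C(u,q)`), the members of type `i` number at most
`C(k,i)·C(m, q − min(i,s))` (`card_Rq_fat_le`), and the level `u` contains the `C(k,j)·C(m, u − min(j,s))` unions
(`card_levelSet_fat_ge_u`); the arithmetic core `rows_arith` does the rest.  Through `GirthRows.rls_of_profileIneq_rows`: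
**C-025 at EVERY `(p, q)` with `p ≤ r` on every «`U_{r,n}` with one fat flat», every `n`** (`rls_modelMatroid_every`).
No `def`, no `instance`, no notation.  Axioms: standard.
-/

open scoped Matroid

namespace PercRepro

open Finset ThmH

namespace OneFlat

variable {α : Type} [DecidableEq α]

/-- The price identity `C(p+q,u)/C(p+q,q) = C(p,u−q)/C(u,q)` (`q ≤ u`). -/
theorem choose_div_choose_eq_choose_div {p q u : ℕ} (hqu : q ≤ u) :
    ((p + q).choose u : ℚ) / ((p + q).choose q : ℚ) = (p.choose (u - q) : ℚ) / (u.choose q : ℚ) := by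
  have h := Nat.choose_mul (n := p + q) (k := u) (s := q) hqu
  rw [Nat.add_sub_cancel] at h
  have h1 : (0 : ℚ) < ((p + q).choose q : ℚ) := by exact_mod_cast Nat.choose_pos (by omega)
  have h2 : (0 : ℚ) < (u.choose q : ℚ) := by exact_mod_cast Nat.choose_pos hqu
  rw [div_eq_div_iff h1.ne' h2.ne']
  have h' : (p + q).choose u * u.choose q = p.choose (u - q) * (p + q).choose q := by rw [h]; ring
  exact_mod_cast h'

section Split

variable (M : Matroid α) [M.Finite] (E₁ E₂ : Finset α) (s r : ℕ)

/-- The rank of the complement of a rank-`q` set with `i` fat points: `min(r, min(k−i,s) + (m − (q − min(i,s))))`. -/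
theorem eRk_compl_eq (hE : gr M = E₁ ∪ E₂)
    (hrk : ∀ X : Finset α, X ⊆ gr M →
      M.eRk (X : Set α) = ((min r (min (X ∩ E₁).card s + (X ∩ E₂).card) : ℕ) : ℕ∞))
    {q : ℕ} (hqr : q < r) {B : Finset α} (hB : B ∈ Profile.Rq M q) :
    M.eRk ((gr M \ B : Finset α) : Set α) =
      ((min r (min (E₁.card - (B ∩ E₁).card) s + (E₂.card - (q - min (B ∩ E₁).card s))) : ℕ) : ℕ∞) := by
  rw [Profile.mem_Rq] at hB
  obtain ⟨hBg, hBq⟩ := hB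
  rw [hrk B hBg] at hBq
  have hBq' : min r (min (B ∩ E₁).card s + (B ∩ E₂).card) = q := by exact_mod_cast hBq
  have hmem : min (B ∩ E₁).card s + (B ∩ E₂).card = q := by omega
  have hE₁g : E₁ ⊆ gr M := by rw [hE]; exact subset_union_left
  have hE₂g : E₂ ⊆ gr M := by rw [hE]; exact subset_union_right
  have hc₁ : ((gr M \ B) ∩ E₁).card = E₁.card - (B ∩ E₁).card := by
    have : (gr M \ B) ∩ E₁ = E₁ \ B := by
      ext x; simp only [mem_inter, mem_sdiff]
      constructor
      · exact fun h => ⟨h.2, h.1.2⟩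
      · exact fun h => ⟨⟨hE₁g h.1, h.2⟩, h.1⟩
    rw [this, card_sdiff]
  have hc₂ : ((gr M \ B) ∩ E₂).card = E₂.card - (B ∩ E₂).card := by
    have : (gr M \ B) ∩ E₂ = E₂ \ B := by
      ext x; simp only [mem_inter, mem_sdiff]
      constructor
      · exact fun h => ⟨h.2, h.1.2⟩
      · exact fun h => ⟨⟨hE₂g h.1, h.2⟩, h.1⟩
    rw [this, card_sdiff]
  rw [hrk (gr M \ B) sdiff_subset, hc₁, hc₂]
  congr 3
  omega

/-- The price of a rank-`q` set with `i` fat points at level `u` is at most the (threshold-`u`) price of the untruncated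
complement rank `p' = min(k−i,s) + (m − (q − min(i,s)))`, in the form `C(p', u−q)/C(u,q)`. -/
theorem price_le_type (hE : gr M = E₁ ∪ E₂)
    (hrk : ∀ X : Finset α, X ⊆ gr M →
      M.eRk (X : Set α) = ((min r (min (X ∩ E₁).card s + (X ∩ E₂).card) : ℕ) : ℕ∞))
    {q u : ℕ} (hqu : q ≤ u) (hqr : q < r) {B : Finset α} (hB : B ∈ Profile.Rq M q) :
    Profile.price M q u B ≤
      (if u ≤ min (E₁.card - (B ∩ E₁).card) s + (E₂.card - (q - min (B ∩ E₁).card s)) then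
        ((min (E₁.card - (B ∩ E₁).card) s + (E₂.card - (q - min (B ∩ E₁).card s))).choose (u - q) : ℚ) /
          (u.choose q : ℚ)
      else 0) := by
  have hp := eRk_compl_eq M E₁ E₂ s r hE hrk hqr hB
  set p' := min (E₁.card - (B ∩ E₁).card) s + (E₂.card - (q - min (B ∩ E₁).card s)) with hp'
  by_cases hup : u ≤ min r p'
  · rw [PriceMono.price_eq_of_le hp hup, if_pos (by omega)]
    calc ((min r p' + q).choose u : ℚ) / ((min r p' + q).choose q : ℚ)
        ≤ ((p' + q).choose u : ℚ) / ((p' + q).choose q : ℚ) :=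
          PriceMono.choose_div_choose_mono hqu hup (min_le_right _ _)
      _ = (p'.choose (u - q) : ℚ) / (u.choose q : ℚ) := choose_div_choose_eq_choose_div hqu
  · have : Profile.price M q u B = 0 := by
      unfold Profile.price
      rw [hp, if_neg (by exact_mod_cast hup)]
    rw [this]
    split_ifs <;> positivity

/-- (`i`-subsets of `E₁`) × (`(u − min(i,s))`-subsets of `E₂`) inject by union into the level `u < r`, fibre `|S ∩ E₁| = i`,
when `min(i,s) ≤ u`. -/
theorem card_levelSet_fat_ge_u (hE : gr M = E₁ ∪ E₂) (hdisj : Disjoint E₁ E₂)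
    (hrk : ∀ X : Finset α, X ⊆ gr M →
      M.eRk (X : Set α) = ((min r (min (X ∩ E₁).card s + (X ∩ E₂).card) : ℕ) : ℕ∞))
    {u : ℕ} (hur : u < r) (i : ℕ) (hiu : min i s ≤ u) :
    E₁.card.choose i * (E₂.card).choose (u - min i s) ≤
      ((Shadow.levelSet M u).filter (fun S => (S ∩ E₁).card = i)).card := by
  have e1 : ∀ (Y Z : Finset α), Y ⊆ E₁ → Z ⊆ E₂ → (Y ∪ Z) ∩ E₁ = Y := by
    intro Y Z hY hZ
    rw [union_inter_distrib_right, inter_eq_left.2 hY,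
      disjoint_iff_inter_eq_empty.1 (disjoint_of_subset_left hZ hdisj.symm), union_empty]
  have e2 : ∀ (Y Z : Finset α), Y ⊆ E₁ → Z ⊆ E₂ → (Y ∪ Z) ∩ E₂ = Z := by
    intro Y Z hY hZ
    rw [union_inter_distrib_right, inter_eq_left.2 hZ,
      disjoint_iff_inter_eq_empty.1 (disjoint_of_subset_left hY hdisj), empty_union]
  rw [← card_powersetCard, ← card_powersetCard, ← card_product]
  apply card_le_card_of_injOn (fun YZ : Finset α × Finset α => YZ.1 ∪ YZ.2)
  · rintro ⟨Y, Z⟩ hYZ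
    simp only [coe_product, Set.mem_prod, mem_coe, mem_powersetCard] at hYZ
    obtain ⟨⟨hY, hYc⟩, hZ, hZc⟩ := hYZ
    have hsub : Y ∪ Z ⊆ gr M := by
      rw [hE]; exact union_subset_union hY hZ
    simp only [coe_filter, Set.mem_setOf_eq, Profile.mem_levelSet]
    refine ⟨⟨hsub, ?_⟩, by rw [e1 Y Z hY hZ]; exact hYc⟩
    rw [hrk (Y ∪ Z) hsub, e1 Y Z hY hZ, e2 Y Z hY hZ, hYc, hZc]
    congr 1
    omega
  · rintro ⟨Y, Z⟩ hYZ ⟨Y', Z'⟩ hYZ' h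
    simp only [coe_product, Set.mem_prod, mem_coe, mem_powersetCard] at hYZ hYZ'
    simp only at h
    have hY : Y = Y' := by
      rw [← e1 Y Z hYZ.1.1 hYZ.2.1, ← e1 Y' Z' hYZ'.1.1 hYZ'.2.1, h]
    have hZ : Z = Z' := by
      rw [← e2 Y Z hYZ.1.1 hYZ.2.1, ← e2 Y' Z' hYZ'.1.1 hYZ'.2.1, h]
    rw [hY, hZ]

/-- **EVERY ROW `(q,u)`, `q < u < r`, ON A UNIFORM FLAT PLUS FREE POINTS, SPLIT FORM**: `M` finite, `gr M = E₁ ⊔ E₂`, the rank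
function `min(r, min(|X ∩ E₁|, s) + |X ∩ E₂|)` — no regime, no size condition. -/
theorem profileIneq_rows_uniformFlat (hE : gr M = E₁ ∪ E₂) (hdisj : Disjoint E₁ E₂)
    (hrk : ∀ X : Finset α, X ⊆ gr M →
      M.eRk (X : Set α) = ((min r (min (X ∩ E₁).card s + (X ∩ E₂).card) : ℕ) : ℕ∞))
    {q u : ℕ} (hqu : q < u) (hur : u < r) :
    Profile.ProfileIneq M q u := by
  unfold Profile.ProfileIneq
  set k := E₁.card with hk
  set m := E₂.card with hmdef
  have hqr : q < r := by omega
  have hCpos : (0 : ℚ) < (u.choose q : ℚ) := by exact_mod_cast Nat.choose_pos hqu.le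
  -- (a) the members, fibred by the number of fat points
  have hmaps : ∀ B ∈ Profile.Rq M q, (B ∩ E₁).card ∈ range (k + 1) := by
    intro B _
    rw [mem_range, Nat.lt_succ_iff]
    exact card_le_card inter_subset_right
  have hA : ∑ B ∈ Profile.Rq M q, Profile.price M q u B ≤
      (∑ i ∈ range (k + 1), (k.choose i : ℚ) *
        (if min i s ≤ q ∧ u ≤ min (k - i) s + (m - (q - min i s)) then
          ((m.choose (q - min i s) : ℚ) * ((min (k - i) s + (m - (q - min i s))).choose (u - q) : ℚ)) else 0)) /
        (u.choose q : ℚ) := by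
    rw [← sum_fiberwise_of_maps_to hmaps, sum_div]
    apply sum_le_sum
    intro i _
    -- every member of the fibre has price at most the type price
    have hw : ∀ B ∈ (Profile.Rq M q).filter (fun B => (B ∩ E₁).card = i),
        Profile.price M q u B ≤
          (if u ≤ min (k - i) s + (m - (q - min i s)) then
            ((min (k - i) s + (m - (q - min i s))).choose (u - q) : ℚ) / (u.choose q : ℚ) else 0) := by
      intro B hB
      rw [mem_filter] at hB
      have := price_le_type M E₁ E₂ s r hE hrk hqu.le hqr hB.1
      rw [hB.2] at this
      exact this
    calc ∑ B ∈ (Profile.Rq M q).filter (fun B => (B ∩ E₁).card = i), Profile.price M q u B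
        ≤ ∑ B ∈ (Profile.Rq M q).filter (fun B => (B ∩ E₁).card = i),
            (if u ≤ min (k - i) s + (m - (q - min i s)) then
              ((min (k - i) s + (m - (q - min i s))).choose (u - q) : ℚ) / (u.choose q : ℚ) else 0) :=
          sum_le_sum hw
      _ = (((Profile.Rq M q).filter (fun B => (B ∩ E₁).card = i)).card : ℚ) *
            (if u ≤ min (k - i) s + (m - (q - min i s)) then
              ((min (k - i) s + (m - (q - min i s))).choose (u - q) : ℚ) / (u.choose q : ℚ) else 0) := by
          rw [sum_const, nsmul_eq_mul]
      _ ≤ ((k.choose i : ℚ) * (if min i s ≤ q then (m.choose (q - min i s) : ℚ) else 0)) *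
            (if u ≤ min (k - i) s + (m - (q - min i s)) then
              ((min (k - i) s + (m - (q - min i s))).choose (u - q) : ℚ) / (u.choose q : ℚ) else 0) := by
          apply mul_le_mul_of_nonneg_right (card_Rq_fat_le M E₁ E₂ s r hE hrk q hqr i)
          split_ifs <;> positivity
      _ = (k.choose i : ℚ) *
            (if min i s ≤ q ∧ u ≤ min (k - i) s + (m - (q - min i s)) then
              ((m.choose (q - min i s) : ℚ) * ((min (k - i) s + (m - (q - min i s))).choose (u - q) : ℚ)) else 0) /
            (u.choose q : ℚ) := by
          by_cases h1 : min i s ≤ q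
          · by_cases h2 : u ≤ min (k - i) s + (m - (q - min i s))
            · rw [if_pos h1, if_pos h2, if_pos ⟨h1, h2⟩]; ring
            · simp [h1, h2]
          · simp [h1]
  -- (b) the level `u`, fibred by the number of fat points
  have hmaps' : ∀ S ∈ Shadow.levelSet M u, (S ∩ E₁).card ∈ range (k + 1) := by
    intro S _
    rw [mem_range, Nat.lt_succ_iff]
    exact card_le_card inter_subset_right
  have hC : (∑ i ∈ range (k + 1), (k.choose i : ℚ) * (if min i s ≤ u then (m.choose (u - min i s) : ℚ) else 0)) ≤
      ((Shadow.levelSet M u).card : ℚ) := by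
    rw [card_eq_sum_card_fiberwise (fun S hS => mem_coe.2 (hmaps' S (mem_coe.1 hS)))]
    push_cast
    apply sum_le_sum
    intro i _
    split_ifs with hiu
    · exact_mod_cast card_levelSet_fat_ge_u M E₁ E₂ s r hE hdisj hrk hur i hiu
    · rw [mul_zero]; positivity
  -- (c) the arithmetic core
  have hT := rows_arith k s m q u hqu.le
  have hT' : ((∑ i ∈ range (k + 1), k.choose i *
      (if min i s ≤ q ∧ u ≤ min (k - i) s + (m - (q - min i s)) then
        m.choose (q - min i s) * (min (k - i) s + (m - (q - min i s))).choose (u - q) else 0) : ℕ) : ℚ) ≤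
      ((u.choose q * ∑ j ∈ range (k + 1), k.choose j * (if min j s ≤ u then m.choose (u - min j s) else 0) : ℕ) : ℚ) := by
    exact_mod_cast hT
  push_cast at hT'
  have hT'' : (∑ i ∈ range (k + 1), (k.choose i : ℚ) *
        (if min i s ≤ q ∧ u ≤ min (k - i) s + (m - (q - min i s)) then
          ((m.choose (q - min i s) : ℚ) * ((min (k - i) s + (m - (q - min i s))).choose (u - q) : ℚ)) else 0)) /
        (u.choose q : ℚ) ≤
      ∑ i ∈ range (k + 1), (k.choose i : ℚ) * (if min i s ≤ u then (m.choose (u - min i s) : ℚ) else 0) := by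
    rw [div_le_iff₀ hCpos, mul_comm]
    convert hT' using 2
  linarith [hA, hC, hT'']

end Split

/-- **EVERY ROW `(q, u)`, `q < u < r`, OF (Π) ON night-1's MODEL `T_r(U_{s,F} ⊕ U_{E∖F,E∖F})`, EVERY SIZE** (`s ≤ r`). -/
theorem profileIneq_rows_modelMatroid_all {E : Set α} (hE : E.Finite) {F : Set α} (hF : F ⊆ E) {s r : ℕ}
    (hsr : s ≤ r) (q u : ℕ) (hqu : q < u) (hur : u < r) :
    haveI := modelMatroid_finite hE F s r
    Profile.ProfileIneq (modelMatroid hE F s r) q u := by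
  classical
  haveI := modelMatroid_finite hE F s r
  have hunion : gr (modelMatroid hE F s r) =
      (gr (modelMatroid hE F s r)).filter (fun x => x ∈ F) ∪ (gr (modelMatroid hE F s r)).filter (fun x => x ∉ F) :=
    (filter_union_filter_not_eq _ _).symm
  have hdisj : Disjoint ((gr (modelMatroid hE F s r)).filter (fun x => x ∈ F))
      ((gr (modelMatroid hE F s r)).filter (fun x => x ∉ F)) := disjoint_filter_filter_not _ _ _
  exact profileIneq_rows_uniformFlat (modelMatroid hE F s r) _ _ s r hunion hdisj
    (fun X hX => modelMatroid_eRk_finset hE hF hsr X hX) hqu hur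

/-- **C-025 AT EVERY `(p, q)` WITH `p ≤ r` ON EVERY «`U_{r,n}` WITH ONE FAT FLAT», EVERY `n`** (night-1's model, `s ≤ r`). -/
theorem rls_modelMatroid_every {E : Set α} (hE : E.Finite) {F : Set α} (hF : F ⊆ E) {s r : ℕ}
    (hsr : s ≤ r) (p q : ℕ) (hpr : p ≤ r) :
    haveI := modelMatroid_finite hE F s r
    ThmN.RLS (modelMatroid hE F s r) p q := by
  haveI := modelMatroid_finite hE F s r
  apply GirthRows.rls_of_profileIneq_rows
  intro u hu1 hu2
  exact profileIneq_rows_modelMatroid_all hE hF hsr q u hu1 (by omega)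

end OneFlat

end PercRepro
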